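import Summits.QuantumFields.BalabanUV.Beta.AxialDressingRootedBmKernel

/-!
# The gauge multiplier of a covariance field whose force has BLOCK-CONSTANT codifferential vanishes; the rows of `Π_bm` are such forces
# (β sub-cell, row BETA-an2, gen 13; the step «`dδd ∘ GamM` dies against `Π̂_bmᵀ`» of the relative-inverse rules 3–4 at `j = 0`)

HONEST FRAMING (cell charter, verbatim): «discharging BetaPertH makes Balaban's UV stability UNCONDITIONAL — a real
constructive-QFT result; it is NOT the continuum limit and NOT the Clay problem.»  DERIVED cell leaf (pub-balaban β sub-cell, lane
an2 gen 13); no statement of Bałaban's papers is typed here, no `[cite:]` tag, no `Prop` fact; it instantiates no binder of the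
β-function wall by itself.  NOT `BetaPertH`; NOT continuum; NOT Clay.

## What is here
* §1 **`McolSum_eq_zero_of_isBlockConst`** — an5's `ResolventComposition.McolSum_eq_zero` («the gauge multiplier of a covariance field with
  CO-CLOSED force vanishes») with the hypothesis weakened to «the codifferential of the force is BLOCK-CONSTANT»: the same energy argument
  (`codiff₁ ∘ curvAdj = 0`, `codiff₁ ∘ 𝒬ᵀ_N` block-constant, (M), two adjunctions, translation invariance), the extra term joining the
  block-constant side;
* §2 ADDITIVITY of the block-mean-normalised projector in the 1-form (`treeGaugeAt_add'`, `axProjBmAt_add`, the additive map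
  `axProjBmAtHom`) and **`axProjBmAt_dz : Π_bm (dz f) = dz (blockMeanAt N f)`** — `Π_bm` kills exactly the gradients of block-mean-constant
  functions (any root offset, `N ≥ 1`);
* §3 THE ROWS OF `Π_bm` AS FORCES: `rowBm ρ N β w := (l, y) ↦ pmBm ρ N β w l y` (`= (Π_bm δ_{(l,y)})_β(w)`); the block mean of a point indicator
  (`blockMeanAt_ind`); **`codiff₁_rowBm`** (`= (dz (blockMeanAt N 𝟙_u))_β(w)`) and **`isBlockConst_codiff₁_rowBm`**.
Consumer: `BorderedHessianResidualDressing` (`resid N ∘ piKBm = piKBmC`), same lane.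

All declarations `[folklore]`; axioms standard.  Provenance: b2b-balaban β sub-cell, unit beta-an2 gen 13, 2026-08-20 (v1); over
`ResolventComposition` §1/§7, `KKTFluctuationEnergy`, `AxialProjectorBlockMean`, `AxialDressingRootedBm`, `AveragingContours(Rooted)` BY NAME.
-/

open Finset
open scoped BigOperators
open Literature.Probability.LatticeModels (TorusSite Torus.proj Torus.proj_apply)
open Literature.MathematicalPhysics.QuantumFieldTheory
open Literature.MathematicalPhysics.QuantumFieldTheory.Balaban1983to89
open Literature.MathematicalPhysics.QuantumFieldTheory.Balaban1983to89.Beta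
open B12Sec2to5 (l1 l1_nonneg)
open AffineAveraging (Form0 Form1 Form2 box toSite unitVec unitVec_apply dz curv curvAdj codiff₁ blockSum contourSum)
open AffineReproduction (contourSumAdj IsBlockConst codiff₁_sub dz_sub dz_add)
open AveragingContours (blk grad grad_eq_dz axial axial_sum_grad axial_sum_sub blk_block off off_mem_box blk_add_off)
open AveragingContoursRooted (treeGaugeAt)
open KKTFluctuationKernel (delta1 delta1_apply GamM_M)
open KKTFluctuationEnergy (lip0 lip1 lip0_codiff₁ lip1_dz summable_dz summable_codiff₁ abs_dz_le abs_codiff₁_le summable_mul_of_bdd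
  tsum_mul_eq_zero_of_blockConst Mcol)
open KernelSpecInstance (codiff₁_add)
open ResolventComposition (δSum McolSum ΦcolSum GcolSum_bdd_summable blockSum_McolSum curvAdj_curv_GcolSum abs_δSum_le
  codiff₁_curvAdj codiff₁_contourSumAdj isBlockConst_codiff₁_contourSumAdj eq_zero_of_summable_of_shift_invariant)
open Summit.QuantumFields.BalabanUV.Beta.AxialDressingRooted (cube mem_cube bondInd bondInd_apply pmBm window_of_pmBm_ne_zero)
open Summit.QuantumFields.BalabanUV.Beta.AxialProjectorBlockMean (blockMeanAt bmGaugeAt axProjBmAt axProjBmAt_eq grad_sub)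

namespace Summit.QuantumFields.BalabanUV.Beta.BorderedHessian

noncomputable section

variable {d : ℕ}

/-! ## §1 The gauge multiplier of a covariance field with block-constant force codifferential vanishes -/

section GaugeMultiplier

variable {N : ℕ} [NeZero N]

/-- [folklore] **THE GAUGE MULTIPLIER OF A COVARIANCE FIELD WHOSE FORCE HAS BLOCK-CONSTANT CODIFFERENTIAL VANISHES.**  For a finite
combination `U = Σ_{b ∈ S} a_b Γ_b` of covariance columns with `codiff₁ (Σ a_b δ_b)` constant on the `N`-blocks, the gauge multiplier
`Σ a_b M_b` is `0` (an5's `McolSum_eq_zero` is the co-closed case). -/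
theorem McolSum_eq_zero_of_isBlockConst (S : Finset (Fin (d + 1) × AffineAveraging.Site (d + 1)))
    (a : Fin (d + 1) × AffineAveraging.Site (d + 1) → ℝ) (hco : IsBlockConst N (codiff₁ (δSum S a))) :
    McolSum (N := N) S a = 0 := by
  obtain ⟨K, _, _, hΦb, hμb, hμs⟩ := GcolSum_bdd_summable (N := N) S a
  have hM : ∀ y, blockSum N (McolSum (N := N) S a) y = 0 := blockSum_McolSum (N := N) S a
  have hEL := curvAdj_curv_GcolSum (N := N) S a
  set μ : Form0 (d + 1) ℝ := McolSum (N := N) S a with hμdef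
  have hg : codiff₁ (dz (codiff₁ (dz μ))) = -codiff₁ (contourSumAdj N (ΦcolSum (N := N) S a)) - codiff₁ (δSum S a) := by
    have h := congrArg codiff₁ hEL
    rw [codiff₁_curvAdj, codiff₁_add, codiff₁_add] at h
    linear_combination -h
  have hgc : IsBlockConst N (codiff₁ (dz (codiff₁ (dz μ)))) := by
    intro y b hb
    rw [hg, Pi.sub_apply, Pi.sub_apply, Pi.neg_apply, Pi.neg_apply, isBlockConst_codiff₁_contourSumAdj _ y b hb, hco y b hb]
  have hδb : ∀ m x, |δSum S a m x| ≤ (∑ b ∈ S, |a b|) * 1 := fun m x => abs_δSum_le S a m x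
  have hgb : ∀ x, |codiff₁ (dz (codiff₁ (dz μ))) x| ≤ (d + 1 : ℕ) * (2 * K) + (d + 1 : ℕ) * (2 * ((∑ b ∈ S, |a b|) * 1)) := by
    intro x
    rw [hg, Pi.sub_apply, Pi.neg_apply]
    have h1 : |codiff₁ (contourSumAdj N (ΦcolSum (N := N) S a)) x| ≤ (d + 1 : ℕ) * (2 * K) := by
      rw [codiff₁_contourSumAdj]; exact abs_codiff₁_le hΦb _
    have h2 : |codiff₁ (δSum S a) x| ≤ (d + 1 : ℕ) * (2 * ((∑ b ∈ S, |a b|) * 1)) := abs_codiff₁_le hδb x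
    calc |-codiff₁ (contourSumAdj N (ΦcolSum (N := N) S a)) x - codiff₁ (δSum S a) x|
        ≤ |-codiff₁ (contourSumAdj N (ΦcolSum (N := N) S a)) x| + |codiff₁ (δSum S a) x| := abs_sub _ _
      _ ≤ _ := by rw [abs_neg]; exact add_le_add h1 h2
  -- step 1: `∑' g·μ = 0`
  have hsum0 : ∑' x, codiff₁ (dz (codiff₁ (dz μ))) x * μ x = 0 :=
    tsum_mul_eq_zero_of_blockConst (N := N) hgb hgc hμs hM
  -- step 2: two adjunctions
  have hdzμ : ∀ κ, Summable (dz μ κ) := fun κ => summable_dz hμs κ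
  have hΔ : Summable (codiff₁ (dz μ)) := summable_codiff₁ hdzμ
  have hdzΔ : ∀ κ, Summable (dz (codiff₁ (dz μ)) κ) := fun κ => summable_dz hΔ κ
  have hdzμb : ∀ κ x, |dz μ κ x| ≤ 2 * K := fun κ x => abs_dz_le hμb κ x
  have hΔb : ∀ x, |codiff₁ (dz μ) x| ≤ (d + 1 : ℕ) * (2 * (2 * K)) := fun x => abs_codiff₁_le hdzμb x
  have e1 : lip0 μ (codiff₁ (dz (codiff₁ (dz μ)))) = lip1 (dz μ) (dz (codiff₁ (dz μ))) := lip0_codiff₁ hμb hdzΔ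
  have e2 : lip1 (dz μ) (dz (codiff₁ (dz μ))) = lip0 (codiff₁ (dz μ)) (codiff₁ (dz μ)) := lip1_dz hdzμb hΔ
  have e0 : lip0 μ (codiff₁ (dz (codiff₁ (dz μ)))) = 0 := by
    unfold KKTFluctuationEnergy.lip0
    rw [← hsum0]
    exact tsum_congr (fun x => mul_comm _ _)
  have hsq : ∑' x, codiff₁ (dz μ) x * codiff₁ (dz μ) x = 0 := by
    have h := e0
    rw [e1, e2] at h
    exact h
  -- step 3: `Δ₀ μ = 0`
  have hΔ0 : codiff₁ (dz μ) = 0 := by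
    have hnn : ∀ x, 0 ≤ codiff₁ (dz μ) x * codiff₁ (dz μ) x := fun x => mul_self_nonneg _
    have hs2 : Summable (fun x => codiff₁ (dz μ) x * codiff₁ (dz μ) x) := summable_mul_of_bdd hΔb hΔ
    have hz := (hasSum_zero_iff_of_nonneg hnn).1 (by rw [← hsq]; exact hs2.hasSum)
    funext x
    exact mul_self_eq_zero.mp (congr_fun hz x)
  -- step 4: `∑ |dμ|² = ⟨dμ, dμ⟩ = ⟨Δ₀ μ, μ⟩ = 0`
  have e3 : lip1 (dz μ) (dz μ) = lip0 (codiff₁ (dz μ)) μ := lip1_dz hdzμb hμs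
  have hsq1 : ∑' x, ∑ κ, dz μ κ x * dz μ κ x = 0 := by
    have h := e3
    rw [hΔ0] at h
    unfold KKTFluctuationEnergy.lip1 KKTFluctuationEnergy.lip0 at h
    simpa using h
  have hdz0 : ∀ κ x, dz μ κ x = 0 := by
    have hnn : ∀ x, 0 ≤ ∑ κ, dz μ κ x * dz μ κ x := fun x => Finset.sum_nonneg fun κ _ => mul_self_nonneg _
    have hs3 : Summable (fun x => ∑ κ, dz μ κ x * dz μ κ x) :=
      summable_sum fun κ _ => summable_mul_of_bdd (hdzμb κ) (hdzμ κ)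
    have hz := (hasSum_zero_iff_of_nonneg hnn).1 (by rw [← hsq1]; exact hs3.hasSum)
    intro κ x
    have hx : ∑ κ, dz μ κ x * dz μ κ x = 0 := congr_fun hz x
    exact mul_self_eq_zero.mp
      ((Finset.sum_eq_zero_iff_of_nonneg (fun κ _ => mul_self_nonneg (dz μ κ x))).1 hx κ (Finset.mem_univ κ))
  -- step 5: translation invariance + summability
  have hinv : ∀ x, μ (x + unitVec 0) = μ x := fun x => by
    have h := hdz0 0 x
    simp only [dz] at h
    linarith
  have hv : (unitVec 0 : AffineAveraging.Site (d + 1)) ≠ 0 := by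
    intro h
    have := congr_fun h 0
    simp [unitVec_apply] at this
  exact eq_zero_of_summable_of_shift_invariant hμs hv hinv

end GaugeMultiplier

/-! ## §2 Additivity of `Π_bm` in the form, and `Π_bm (dz f) = dz (blockMeanAt N f)` -/

section PiBm

/-- [folklore] The rooted tree integral is additive in the form. -/
theorem treeGaugeAt_add' (ρ : Fin (d + 1) → ℤ) (A B : Form1 (d + 1) ℝ) (N : ℕ) :
    treeGaugeAt ρ (A + B) N = treeGaugeAt ρ A N + treeGaugeAt ρ B N := by
  funext x
  simp only [treeGaugeAt, Pi.add_apply]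
  have h := axial_sum_sub (A + B) B ((N : ℤ) • blk N x + ρ) x
  rw [add_sub_cancel_right] at h
  linarith

/-- [folklore] The rooted tree integral is subtractive in the form. -/
theorem treeGaugeAt_sub' (ρ : Fin (d + 1) → ℤ) (A B : Form1 (d + 1) ℝ) (N : ℕ) :
    treeGaugeAt ρ (A - B) N = treeGaugeAt ρ A N - treeGaugeAt ρ B N := by
  funext x
  simp only [treeGaugeAt, Pi.sub_apply]
  exact axial_sum_sub A B _ x

/-- [folklore] The block mean is additive. -/
theorem blockMeanAt_add (N : ℕ) (f g : Form0 (d + 1) ℝ) : blockMeanAt N (f + g) = blockMeanAt N f + blockMeanAt N g := by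
  funext x
  simp only [blockMeanAt, blockSum, Pi.add_apply, Finset.sum_add_distrib, add_div]

/-- [folklore] The block mean is subtractive. -/
theorem blockMeanAt_sub (N : ℕ) (f g : Form0 (d + 1) ℝ) : blockMeanAt N (f - g) = blockMeanAt N f - blockMeanAt N g := by
  funext x
  simp only [blockMeanAt, blockSum, Pi.sub_apply, Finset.sum_sub_distrib, sub_div]

/-- [folklore] `grad` is additive. -/
theorem grad_add (f g : Form0 (d + 1) ℝ) : grad (f + g) = grad f + grad g := by
  funext κ x; simp only [grad, Pi.add_apply]; ring

/-- [folklore] **`Π_bm` IS ADDITIVE IN THE FORM.** -/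
theorem axProjBmAt_add (ρ : Fin (d + 1) → ℤ) (N : ℕ) (A B : Form1 (d + 1) ℝ) :
    axProjBmAt ρ N (A + B) = axProjBmAt ρ N A + axProjBmAt ρ N B := by
  unfold AxialProjectorBlockMean.axProjBmAt AxialProjectorBlockMean.bmGaugeAt
  rw [treeGaugeAt_add', blockMeanAt_add, show treeGaugeAt ρ A N + treeGaugeAt ρ B N - (blockMeanAt N (treeGaugeAt ρ A N) +
      blockMeanAt N (treeGaugeAt ρ B N)) = (treeGaugeAt ρ A N - blockMeanAt N (treeGaugeAt ρ A N)) +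
      (treeGaugeAt ρ B N - blockMeanAt N (treeGaugeAt ρ B N)) by abel, grad_add]
  abel

/-- [folklore] **`Π_bm` IS SUBTRACTIVE IN THE FORM.** -/
theorem axProjBmAt_sub (ρ : Fin (d + 1) → ℤ) (N : ℕ) (A B : Form1 (d + 1) ℝ) :
    axProjBmAt ρ N (A - B) = axProjBmAt ρ N A - axProjBmAt ρ N B := by
  have h := axProjBmAt_add ρ N (A - B) B
  rw [sub_add_cancel] at h
  rw [h, add_sub_cancel_right]

/-- [folklore] The entry `(Π_bm ·)_β(w)` as an additive map of the form. -/
def axProjBmAtHom (ρ : Fin (d + 1) → ℤ) (N : ℕ) (β : Fin (d + 1)) (w : Fin (d + 1) → ℤ) : Form1 (d + 1) ℝ →+ ℝ where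
  toFun A := axProjBmAt ρ N A β w
  map_zero' := by
    have h := axProjBmAt_sub ρ N (0 : Form1 (d + 1) ℝ) 0
    rw [sub_zero, sub_self] at h
    exact congr_fun (congr_fun h β) w
  map_add' A B := by rw [axProjBmAt_add]; rfl

/-- [folklore] `axProjBmAtHom` evaluates `Π_bm`. -/
theorem axProjBmAtHom_apply (ρ : Fin (d + 1) → ℤ) (N : ℕ) (β : Fin (d + 1)) (w : Fin (d + 1) → ℤ) (A : Form1 (d + 1) ℝ) :
    axProjBmAtHom ρ N β w A = axProjBmAt ρ N A β w := rfl

/-- [folklore] The rooted tree integral of an exact form: `λ^ρ_{dz f}(x) = f x − f (root of the block of x)`. -/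
theorem treeGaugeAt_dz (ρ : Fin (d + 1) → ℤ) (f : Form0 (d + 1) ℝ) (N : ℕ) (x : Fin (d + 1) → ℤ) :
    treeGaugeAt ρ (dz f) N x = f x - f ((N : ℤ) • blk N x + ρ) := by
  unfold treeGaugeAt
  rw [← grad_eq_dz, axial_sum_grad]

/-- [folklore] The block mean of a block-constant function (read through the block) is the function. -/
theorem blockMeanAt_blockConst' {N : ℕ} (hN : 1 ≤ N) (g : (Fin (d + 1) → ℤ) → ℝ) (x : Fin (d + 1) → ℤ) :
    blockMeanAt N (fun x' => g (blk N x')) x = g (blk N x) := by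
  unfold blockMeanAt blockSum
  have hcard : (box (d + 1) N).card = N ^ (d + 1) := by
    simp only [AffineAveraging.box, Fintype.card_piFinset, Finset.card_range, Finset.prod_const, Finset.card_univ, Fintype.card_fin]
  have hNn : ((N : ℝ) ^ (d + 1)) ≠ 0 := pow_ne_zero _ (by exact_mod_cast (show N ≠ 0 by omega))
  have e : ∀ b ∈ box (d + 1) N, (fun x' => g (blk N x')) ((N : ℤ) • blk N x + toSite b) = g (blk N x) := by
    intro b hb
    show g (blk N ((N : ℤ) • blk N x + toSite b)) = g (blk N x)
    rw [blk_block (blk N x) hb]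
  rw [Finset.sum_congr rfl e, Finset.sum_const, hcard, nsmul_eq_mul]
  push_cast
  field_simp

/-- [folklore] **`Π_bm` ON EXACT FORMS**: `Π^ρ_bm (dz f) = dz (blockMeanAt N f)` — the block-mean-normalised projector kills exactly the
gradients of functions with block-constant block means (any root offset; `N ≥ 1`). -/
theorem axProjBmAt_dz (ρ : Fin (d + 1) → ℤ) {N : ℕ} (hN : 1 ≤ N) (f : Form0 (d + 1) ℝ) :
    axProjBmAt ρ N (dz f) = dz (blockMeanAt N f) := by
  have htg : treeGaugeAt ρ (dz f) N = f - fun x => f ((N : ℤ) • blk N x + ρ) := by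
    funext x; rw [treeGaugeAt_dz]; rfl
  have hbm : blockMeanAt N (treeGaugeAt ρ (dz f) N) = blockMeanAt N f - fun x => f ((N : ℤ) • blk N x + ρ) := by
    rw [htg, blockMeanAt_sub]
    congr 1
    funext x
    exact blockMeanAt_blockConst' hN (fun y => f ((N : ℤ) • y + ρ)) x
  unfold AxialProjectorBlockMean.axProjBmAt AxialProjectorBlockMean.bmGaugeAt
  rw [hbm, htg, show (f - fun x => f ((N : ℤ) • blk N x + ρ)) - (blockMeanAt N f - fun x => f ((N : ℤ) • blk N x + ρ)) =
    f - blockMeanAt N f by abel, grad_eq_dz, dz_sub]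
  abel

end PiBm

/-! ## §3 The rows of `Π_bm` as forces: their codifferential is block-constant -/

section Rows

/-- [folklore] THE ROW `(β, w)` OF `Π^ρ_bm` as a fine 1-form in the column index: `rowBm ρ N β w l y := pmBm ρ N β w l y = (Π^ρ_bm δ_{(l,y)})_β(w)`. -/
def rowBm (ρ : Fin (d + 1) → ℤ) (N : ℕ) (β : Fin (d + 1)) (w : Fin (d + 1) → ℤ) : Form1 (d + 1) ℝ := fun l y => pmBm ρ N β w l y

/-- [folklore] Entries of `rowBm`. -/
@[simp] theorem rowBm_apply (ρ : Fin (d + 1) → ℤ) (N : ℕ) (β : Fin (d + 1)) (w : Fin (d + 1) → ℤ) (l : Fin (d + 1)) (y : Fin (d + 1) → ℤ) :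
    rowBm ρ N β w l y = pmBm ρ N β w l y := rfl

/-- [folklore] The real indicator of a bond is the cell's `delta1`. -/
theorem bondInd_cast_eq_delta1' (α : Fin (d + 1)) (q : Fin (d + 1) → ℤ) :
    (fun κ z => (bondInd α q κ z : ℝ)) = delta1 α q := by
  funext κ z
  rw [bondInd_apply, delta1_apply]
  split_ifs <;> simp

/-- [folklore] `rowBm` through `Π_bm`: `rowBm ρ N β w l y = (Π^ρ_bm δ_{(l,y)})_β(w)`. -/
theorem rowBm_eq_axProjBmAt (ρ : Fin (d + 1) → ℤ) (N : ℕ) (β : Fin (d + 1)) (w : Fin (d + 1) → ℤ) (l : Fin (d + 1))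
    (y : Fin (d + 1) → ℤ) : rowBm ρ N β w l y = axProjBmAt ρ N (delta1 l y) β w := by
  rw [rowBm_apply, ← bondInd_cast_eq_delta1']
  rfl

/-- [folklore] The POINT INDICATOR `𝟙_u`. -/
def ind (u : Fin (d + 1) → ℤ) : Form0 (d + 1) ℝ := fun y => if y = u then 1 else 0

/-- [folklore] `Σ_l (δ_{(l, u − e_l)} − δ_{(l, u)}) = dz 𝟙_u` as 1-forms. -/
theorem sum_delta1_sub_eq_dz_ind (u : Fin (d + 1) → ℤ) :
    ∑ l : Fin (d + 1), (delta1 l (u - unitVec l) - delta1 l u) = dz (ind u) := by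
  funext μ y
  rw [Finset.sum_apply, Finset.sum_apply, Finset.sum_eq_single μ]
  · simp only [Pi.sub_apply, delta1_apply, dz, ind, true_and]
    have e : (y = u - unitVec μ) ↔ (y + unitVec μ = u) := by
      constructor
      · intro h; rw [h]; abel
      · intro h; rw [← h]; abel
    by_cases h1 : y = u - unitVec μ
    · rw [if_pos h1, if_pos (e.1 h1)]
    · rw [if_neg h1, if_neg (fun h => h1 (e.2 h))]
  · intro l _ hl
    simp only [Pi.sub_apply, delta1_apply, if_neg (fun h : μ = l ∧ _ => hl h.1.symm), sub_self]
  · intro h; exact absurd (Finset.mem_univ μ) h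

/-- [folklore] **THE CODIFFERENTIAL OF A ROW OF `Π_bm`**: `codiff₁ (rowBm ρ N β w) u = (dz (blockMeanAt N 𝟙_u))_β(w)` (`N ≥ 1`). -/
theorem codiff₁_rowBm (ρ : Fin (d + 1) → ℤ) {N : ℕ} (hN : 1 ≤ N) (β : Fin (d + 1)) (w u : Fin (d + 1) → ℤ) :
    codiff₁ (rowBm ρ N β w) u = dz (blockMeanAt N (ind u)) β w := by
  simp only [codiff₁, rowBm_eq_axProjBmAt]
  have h : ∑ l : Fin (d + 1), (axProjBmAt ρ N (delta1 l (u - unitVec l)) β w - axProjBmAt ρ N (delta1 l u) β w)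
      = axProjBmAtHom ρ N β w (∑ l : Fin (d + 1), (delta1 l (u - unitVec l) - delta1 l u)) := by
    rw [map_sum]
    refine Finset.sum_congr rfl fun l _ => ?_
    rw [map_sub, axProjBmAtHom_apply, axProjBmAtHom_apply]
  rw [h, sum_delta1_sub_eq_dz_ind, axProjBmAtHom_apply, axProjBmAt_dz ρ hN]

/-- [folklore] The block sum of a point indicator: `1` on the block of the point, `0` elsewhere. -/
theorem blockSum_ind {N : ℕ} (hN : 1 ≤ N) (u y : Fin (d + 1) → ℤ) : blockSum N (ind u) y = if blk N u = y then 1 else 0 := by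
  unfold blockSum ind
  by_cases hy : blk N u = y
  · rw [if_pos hy, Finset.sum_eq_single (off N u)]
    · rw [if_pos]
      rw [← hy]; exact blk_add_off hN u
    · intro b hb hne
      rw [if_neg]
      intro h
      apply hne
      have h2 : (N : ℤ) • y + toSite b = (N : ℤ) • y + toSite (off N u) := by rw [h, ← hy, blk_add_off hN u]
      have h3 : toSite b = toSite (off N u) := add_left_cancel h2
      funext i
      have := congr_fun h3 i
      simp only [toSite] at this
      exact_mod_cast this
    · intro h; exact absurd (off_mem_box hN u) h
  · rw [if_neg hy]
    refine Finset.sum_eq_zero fun b hb => ?_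
    rw [if_neg]
    intro h
    exact hy (by rw [← h, blk_block y hb])

/-- [folklore] The block mean of a point indicator: `N^{−(d+1)}` on the block of the point, `0` elsewhere. -/
theorem blockMeanAt_ind {N : ℕ} (hN : 1 ≤ N) (u x : Fin (d + 1) → ℤ) :
    blockMeanAt N (ind u) x = if blk N u = blk N x then ((N : ℝ) ^ (d + 1))⁻¹ else 0 := by
  unfold blockMeanAt
  rw [blockSum_ind hN]
  split_ifs <;> simp [div_eq_inv_mul]

/-- [folklore] **THE CODIFFERENTIAL OF EVERY ROW OF `Π_bm` IS BLOCK-CONSTANT** (it depends on the site only through its block). -/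
theorem isBlockConst_codiff₁_rowBm (ρ : Fin (d + 1) → ℤ) {N : ℕ} (hN : 1 ≤ N) (β : Fin (d + 1)) (w : Fin (d + 1) → ℤ) :
    IsBlockConst N (codiff₁ (rowBm ρ N β w)) := by
  intro y b hb
  rw [codiff₁_rowBm ρ hN, codiff₁_rowBm ρ hN]
  simp only [dz, blockMeanAt_ind hN, blk_block y hb]
  have h0 : blk N ((N : ℤ) • y) = y := by
    have := blk_block (L := N) y (b := fun _ => 0) (Fintype.mem_piFinset.2 fun _ => Finset.mem_range.2 (by omega))
    simpa [toSite] using this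
  rw [h0]

/-- [folklore] **THE GAUGE MULTIPLIER OF THE COVARIANCE FIELD DRIVEN BY A ROW OF `Π_bm` VANISHES**: for every finite `S` and the weights
`a (l, y) := pmBm ρ N β w l y` whose force `δSum S a` IS the row (i.e. `S` carries the row's support), `McolSum S a = 0`. -/
theorem McolSum_rowBm_eq_zero {N : ℕ} [NeZero N] (ρ : Fin (d + 1) → ℤ) (β : Fin (d + 1)) (w : Fin (d + 1) → ℤ)
    (S : Finset (Fin (d + 1) × AffineAveraging.Site (d + 1))) (hS : δSum S (fun b => pmBm ρ N β w b.1 b.2) = rowBm ρ N β w) :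
    McolSum (N := N) S (fun b => pmBm ρ N β w b.1 b.2) = 0 :=
  McolSum_eq_zero_of_isBlockConst S _ (by rw [hS]; exact isBlockConst_codiff₁_rowBm ρ (Nat.one_le_iff_ne_zero.mpr (NeZero.ne N)) β w)

end Rows

end

end Summit.QuantumFields.BalabanUV.Beta.BorderedHessian
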